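/-
Copyright (c) 2026. All rights reserved.
Released under Apache 2.0 license as described in the file LICENSE.
Authors: abc-iut cell, seat abc-iut-L6-t6 (proof-only tool over abc-iut-found's Definition 1.3 API).
-/
import Mathlib.CategoryTheory.IsConnected
import Literature.AlgebraicGeometry.Frobenioids.PreFrobenioidEquivalenceTransport
import Literature.AlgebraicGeometry.Frobenioids.PreFrobenioidPullbacks
import Literature.AlgebraicGeometry.Frobenioids.IsometricPreSteps
import Literature.AlgebraicGeometry.Frobenioids.IsotropicFrobeniusTrivial
import HarnessLib

/-!
# Frobenioids I: a category equivalent to a (pre-)Frobenioid is a (pre-)Frobenioid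

Mochizuki, *The geometry of Frobenioids I: the general theory*, Kyushu J. Math. **62** (2008), §1,
Definition 1.1 (iv) (pre-Frobenioids, kurims p. 19) and Definition 1.3 (Frobenioids, kurims pp. 24–27)
[cite: MochizukiFrdI2008, Def. 1.3 p.24]. Both definitions are conditions on a functor `F : C → F_Φ` that
are invariant under replacing `C` by an equivalent category: for an equivalence `e : C' ≌ C`, the induced
structure `e.functor ⋙ F` on `C'` is a pre-Frobenioid (resp. Frobenioid) as soon as `F` is
(`IsPreFrobenioid.comp_equivalence`, `IsFrobenioid.comp_equivalence`; also the `Functor.IsEquivalence`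
forms). This is the (tacit) step behind working with an arbitrary category equivalent to a model Frobenioid
(as in [IUTchI] Example 5.1 (iii), where `†ℱ^⊛` is any category equivalent to `ℱ^⊛(†𝒟^⊚)`, and [IUTchIII]
Example 3.6; [FrdI] Thm. 5.2 (iv) p.101 supplies the equivalence from `C` to a model Frobenioid). The proof
is a clause-by-clause transport over `PreFrobenioidEquivalence(Transport).lean`: the existential clauses of
Definition 1.3 are witnessed in `C`, moved into the essential image of `e` along the counit isomorphisms,
and pulled back through the fully faithful `e.functor`; the uniqueness clauses are reflected by
faithfulness; (i)(c) uses that `C^pl-bk_A → D_{A_D}` is already full and faithful in any pre-Frobenioid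
(abc-iut-found, `PreFrobenioidPullbacks.lean`) so that only essential surjectivity is transported. No new
notion is defined; no statement of the paper is strengthened.
-/

namespace Literature.AlgebraicGeometry.Frobenioids

open CategoryTheory Opposite

universe w v v' v'' u u' u''

namespace PreFrobenioid

variable {D : Type u} [Category.{v} D] {Φ : Dᵒᵖ ⥤ CommMonCat.{w}}
  {C : Type u'} [Category.{v'} C] {C' : Type u''} [Category.{v''} C']
  {F : C ⥤ ElemFrobenioid Φ} (e : C' ≌ C)

/-! ### Definition 1.1 (iv) along an equivalence -/

/-- **A category equivalent to a pre-Frobenioid is a pre-Frobenioid** (same divisor monoid and base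
category; connectedness and total epimorphicity of `C` pass along the equivalence).
[cite: MochizukiFrdI2008, Def. 1.1(iv) p.19] -/
theorem _root_.Literature.AlgebraicGeometry.Frobenioids.IsPreFrobenioid.comp_equivalence
    (hP : IsPreFrobenioid Φ F) : IsPreFrobenioid Φ (e.functor ⋙ F) where
  isMonoidOn := hP.isMonoidOn
  isDivisorial := hP.isDivisorial
  isGraphConnected_base := hP.isGraphConnected_base
  isTotallyEpimorphic_base := hP.isTotallyEpimorphic_base
  isGraphConnected := by
    haveI : IsConnected C := (isGraphConnected_iff_isConnected (C := C)).mp hP.isGraphConnected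
    exact (isGraphConnected_iff_isConnected (C := C')).mpr (isConnected_of_equivalent e.symm)
  isTotallyEpimorphic :=
    ⟨fun f => e.functor.epi_of_epi_map (hP.isTotallyEpimorphic.epi (e.functor.map f))⟩

/-! ### Definition 1.3 (i)(c) along an equivalence -/

/-- For a Frobenioid `F`, the functor `C'^pl-bk_A → D_{A_D}` of the structure `e ⋙ F` is essentially
surjective: an object of `D` over `A_D` is reached, by (i)(c) for `F`, from a pull-back morphism into
`e A`, whose domain is moved into the essential image of `e`. [cite: MochizukiFrdI2008, Def. 1.3(i) p.24] -/
theorem pullbackSliceToBase_essSurj_of_equivalence (hF : IsFrobenioid F) (A : C') :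
    (pullbackSliceToBase (e.functor ⋙ F) A).EssSurj := by
  haveI := hF.i_c (e.functor.obj A)
  refine ⟨fun d => ?_⟩
  -- `d` is an object of `D` over `Base(e A) = Base_{e ⋙ F}(A)`
  let Y := (pullbackSliceToBase F (e.functor.obj A)).objPreimage d
  let iY : (pullbackSliceToBase F (e.functor.obj A)).obj Y ≅ d :=
    (pullbackSliceToBase F (e.functor.obj A)).objObjPreimageIso d
  -- `Y.hom.1 : B ⟶ e A` is a pull-back morphism of `F`; move `B` into the essential image
  let B : C := Y.left.obj
  let ψ : B ⟶ e.functor.obj A := Y.hom.1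
  have hψ : IsPullbackMorphism F ψ := Y.hom.2
  let cB : e.functor.obj (e.inverse.obj B) ≅ B := e.counitIso.app B
  let ψ' : e.inverse.obj B ⟶ A := e.functor.preimage (cB.hom ≫ ψ)
  have hψ' : e.functor.map ψ' = cB.hom ≫ ψ := e.functor.map_preimage _
  have hψ'pb : IsPullbackMorphism (e.functor ⋙ F) ψ' := by
    refine IsPullbackMorphism.of_equivalence e ?_
    rw [hψ']
    exact IsPullbackMorphism.comp F (isPullbackMorphism_of_isIso F cB.hom) hψ
  let Y' : Over (⟨A⟩ : PullbackCat (e.functor ⋙ F)) :=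
    Over.mk (Y := (⟨e.inverse.obj B⟩ : PullbackCat (e.functor ⋙ F))) ⟨ψ', hψ'pb⟩
  refine ⟨Y', ⟨?_⟩⟩
  -- the image of `Y'` is `Base(e ψ') = Base(cB) ≫ Base(ψ)` over `Base(e A)`; compare with `d` via `iY`
  have hw : iY.hom.left ≫ d.hom = Base F ψ := Over.w iY.hom
  refine Over.isoMk ((baseFunctor F).mapIso cB ≪≫ (Over.forget _).mapIso iY) ?_
  show (Base F cB.hom ≫ iY.hom.left) ≫ d.hom = Base F (e.functor.map ψ')
  rw [hψ', base_comp, Category.assoc]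
  congr 1

/-- For a Frobenioid `F`, `C'^pl-bk_A → D_{A_D}` is an equivalence for the structure `e ⋙ F`
(Definition 1.3 (i)(c) along `e`). [cite: MochizukiFrdI2008, Def. 1.3(i) p.24] -/
theorem isEquivalence_pullbackSliceToBase_of_equivalence (hF : IsFrobenioid F) (A : C') :
    (pullbackSliceToBase (e.functor ⋙ F) A).IsEquivalence :=
  haveI := pullbackSliceToBase_faithful (e.functor ⋙ F) A
  haveI := pullbackSliceToBase_full (e.functor ⋙ F) A
  haveI := pullbackSliceToBase_essSurj_of_equivalence e hF A
  { }

/-! ### Definition 1.3 along an equivalence -/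

/-- **A category equivalent to a Frobenioid is a Frobenioid**: for an equivalence `e : C' ≌ C` and a
Frobenioid `F : C → F_Φ`, the composite `C' → C → F_Φ` is a Frobenioid (all of Definition 1.3
(i)–(vii), clause by clause). [cite: MochizukiFrdI2008, Def. 1.3 p.24] -/
theorem IsFrobenioid.comp_equivalence (hF : IsFrobenioid F) : IsFrobenioid (e.functor ⋙ F) := by
  have hP : IsPreFrobenioid Φ F := hF.isPreFrobenioid
  have cI : ∀ X : C, e.functor.obj (e.inverse.obj X) ≅ X := fun X => e.counitIso.app X
  refine
    { isPreFrobenioid := hP.comp_equivalence e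
      i_a := ?_, i_b := ?_, i_c := isEquivalence_pullbackSliceToBase_of_equivalence e hF
      ii_exists := ?_, ii_unique := ?_
      iii_a := ?_, iii_b := ?_, iii_c := ?_, iii_c_base := ?_
      iii_d_under_full := ?_, iii_d_under_surj := ?_, iii_d_over_full := ?_, iii_d_over_surj := ?_
      iv_a_exists := ?_, iv_a_unique := ?_, iv_b := ?_
      v_a := ?_, v_b_exists := ?_, v_b_unique := ?_, v_c_exists := ?_, v_c_unique := ?_
      vi := ?_, vii_a := ?_, vii_b := ?_ }
  -- (i)(a)
  · intro A₀
    obtain ⟨A, hA, ⟨i⟩⟩ := hF.i_a A₀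
    refine ⟨e.inverse.obj A, ?_, ⟨(baseFunctor F).mapIso (cI A) ≪≫ i⟩⟩
    exact IsFrobeniusTrivial.of_equivalence e (IsFrobeniusTrivial.of_iso F hF (cI A).symm hA)
  -- (i)(b)
  · intro A B α
    obtain ⟨X, φ, ψ, hφ, hψ, h⟩ := hF.i_b (e.functor.obj A) (e.functor.obj B) α
    refine ⟨e.inverse.obj X, e.functor.preimage ((cI X).hom ≫ φ),
      e.functor.preimage ((cI X).hom ≫ ψ), ?_, ?_, ?_⟩
    · show IsPreStep F (e.functor.map _)
      rw [e.functor.map_preimage]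
      exact IsPreStep.comp F (isPreStep_of_isIso F (cI X).hom) hφ
    · show IsPreStep F (e.functor.map _)
      rw [e.functor.map_preimage]
      exact IsPreStep.comp F (isPreStep_of_isIso F (cI X).hom) hψ
    · show Base F (e.functor.map (e.functor.preimage ((cI X).hom ≫ φ))) ≫ α.hom =
        Base F (e.functor.map (e.functor.preimage ((cI X).hom ≫ ψ)))
      rw [e.functor.map_preimage, e.functor.map_preimage, base_comp, base_comp, Category.assoc]
      congr 1
  -- (ii) existence
  · intro A n
    obtain ⟨B, φ, hφ, hn⟩ := hF.ii_exists (e.functor.obj A) n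
    refine ⟨e.inverse.obj B, e.functor.preimage (φ ≫ (cI B).inv), ?_, ?_⟩
    · refine IsFrobeniusType.of_equivalence e ?_
      rw [e.functor.map_preimage]
      exact hφ.comp_iso hP (cI B).inv
    · show degFr F (e.functor.map _) = n
      rw [e.functor.map_preimage, degFr_comp_iso]
      exact hn
  -- (ii) uniqueness
  · intro A B B' φ ψ hφ hψ hn
    obtain ⟨β, hβ⟩ := hF.ii_unique (e.functor.map φ) (e.functor.map ψ)
      ((isFrobeniusType_equivalence_iff e hP φ).mp hφ)
      ((isFrobeniusType_equivalence_iff e hP ψ).mp hψ) hn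
    refine ⟨e.functor.preimageIso β, e.functor.map_injective ?_⟩
    rw [Functor.map_comp, Functor.preimageIso_hom, e.functor.map_preimage, hβ]
  -- (iii)(a)
  · intro X Y Z f g hf hg
    refine IsCoAngular.of_equivalence e ?_
    rw [Functor.map_comp]
    exact hF.iii_a _ _ (hf.map_of_equivalence e hP) (hg.map_of_equivalence e hP)
  -- (iii)(b)
  · intro A' A φ hφ ψ
    exact IsCoAngular.of_equivalence e
      (hF.iii_b (e.functor.map φ) ((isCoAngularPreStep_equivalence_iff e hP φ).mp hφ)
        (e.functor.map ψ))
  -- (iii)(c)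
  · intro A B φ hφ
    obtain ⟨EA, hEA⟩ := exists_endSubmonoid_mulEquiv e (F := F) A
    obtain ⟨EB, hEB⟩ := exists_endSubmonoid_mulEquiv e (F := F) B
    obtain ⟨E, hE⟩ := hF.iii_c (e.functor.map φ) ((isCoAngularPreStep_equivalence_iff e hP φ).mp hφ)
    refine ⟨(EA.trans E).trans EB.symm, fun α => ?_⟩
    apply e.functor.map_injective
    have h1 : e.functor.map (((EA.trans E).trans EB.symm α : endSubmonoid (e.functor ⋙ F) B) : End B) =
        ((E (EA α) : endSubmonoid F (e.functor.obj B)) : End (e.functor.obj B)) := by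
      have h := hEB (EB.symm (E (EA α)))
      rw [MulEquiv.apply_symm_apply] at h
      exact h.symm
    have h2 := hE (EA α)
    rw [hEA α] at h2
    show e.functor.map (φ ≫ _) = e.functor.map (_ ≫ φ)
    rw [Functor.map_comp, Functor.map_comp, h1]
    exact h2
  -- (iii)(c), dependence on Base only
  · intro A B φ φ' hφ hφ' hb α β β' h1 h2
    obtain ⟨EA, hEA⟩ := exists_endSubmonoid_mulEquiv e (F := F) A
    obtain ⟨EB, hEB⟩ := exists_endSubmonoid_mulEquiv e (F := F) B
    have key := hF.iii_c_base (e.functor.map φ) (e.functor.map φ')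
      ((isCoAngularPreStep_equivalence_iff e hP φ).mp hφ)
      ((isCoAngularPreStep_equivalence_iff e hP φ').mp hφ') hb (EA α) (EB β) (EB β')
      (by
        rw [hEB, hEA, ← Functor.map_comp, ← Functor.map_comp]
        exact congrArg e.functor.map h1)
      (by
        rw [hEB, hEA, ← Functor.map_comp, ← Functor.map_comp]
        exact congrArg e.functor.map h2)
    exact EB.injective key
  -- (iii)(d) coslice, full
  · intro A B B' φ φ' hφ hφ' hd
    obtain ⟨f, hf, hcomp⟩ := hF.iii_d_under_full (e.functor.map φ) (e.functor.map φ')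
      ((isCoAngularPreStep_equivalence_iff e hP φ).mp hφ)
      ((isCoAngularPreStep_equivalence_iff e hP φ').mp hφ') hd
    refine ⟨e.functor.preimage f, (isCoAngularPreStep_equivalence_iff e hP _).mpr ?_,
      e.functor.map_injective ?_⟩
    · rw [e.functor.map_preimage]
      exact hf
    · rw [Functor.map_comp, e.functor.map_preimage, hcomp]
  -- (iii)(d) coslice, essentially surjective
  · intro A x
    obtain ⟨B, φ, hφ, hx⟩ := hF.iii_d_under_surj (e.functor.obj A) x
    refine ⟨e.inverse.obj B, e.functor.preimage (φ ≫ (cI B).inv),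
      (isCoAngularPreStep_equivalence_iff e hP _).mpr ?_, ?_⟩
    · rw [e.functor.map_preimage]
      exact hφ.comp_iso (cI B).inv
    · show Div F (e.functor.map _) = x
      rw [e.functor.map_preimage, div_comp_iso hP]
      exact hx
  -- (iii)(d) slice, full
  · intro A B B' ψ ψ' h h' hd
    obtain ⟨g, hg, hcomp⟩ := hF.iii_d_over_full (e.functor.map ψ) (e.functor.map ψ')
      ((isCoAngularPreStep_equivalence_iff e hP ψ).mp h)
      ((isCoAngularPreStep_equivalence_iff e hP ψ').mp h') hd
    refine ⟨e.functor.preimage g, (isCoAngularPreStep_equivalence_iff e hP _).mpr ?_,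
      e.functor.map_injective ?_⟩
    · rw [e.functor.map_preimage]
      exact hg
    · rw [Functor.map_comp, e.functor.map_preimage, hcomp]
  -- (iii)(d) slice, essentially surjective
  · intro A x
    obtain ⟨B, ψ, h, hx⟩ := hF.iii_d_over_surj (e.functor.obj A) x
    have h' : IsCoAngularPreStep F ((cI B).hom ≫ ψ) := h.iso_comp (cI B).hom
    have h'' : IsCoAngularPreStep (e.functor ⋙ F) (e.functor.preimage ((cI B).hom ≫ ψ)) := by
      refine (isCoAngularPreStep_equivalence_iff e hP _).mpr ?_
      rw [e.functor.map_preimage]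
      exact h'
    refine ⟨e.inverse.obj B, e.functor.preimage ((cI B).hom ≫ ψ), h'', ?_⟩
    have hm : e.functor.map (e.functor.preimage ((cI B).hom ≫ ψ)) = (cI B).hom ≫ ψ :=
      e.functor.map_preimage _
    have key : invDiv F (e.functor.map (e.functor.preimage ((cI B).hom ≫ ψ))) h''.2.2 =
        invDiv F ((cI B).hom ≫ ψ) h'.2.2 := by
      congr 1
    show invDiv F (e.functor.map (e.functor.preimage ((cI B).hom ≫ ψ))) h''.2.2 = x
    rw [key, invDiv_iso_comp hP (cI B).hom ψ h.2.2]
    exact hx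
  -- (iv)(a) existence
  · intro A B φ
    obtain ⟨X, Y, γ, β, α, hfac, hγ, hβ, hα⟩ := hF.iv_a_exists (e.functor.map φ)
    refine ⟨e.inverse.obj X, e.inverse.obj Y, e.functor.preimage (γ ≫ (cI X).inv),
      e.functor.preimage ((cI X).hom ≫ β ≫ (cI Y).inv), e.functor.preimage ((cI Y).hom ≫ α),
      ?_, ?_, ?_, ?_⟩
    · apply e.functor.map_injective
      simp only [Functor.map_comp, Functor.map_preimage, Category.assoc, Iso.inv_hom_id_assoc]
      exact hfac
    · refine IsFrobeniusType.of_equivalence e ?_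
      rw [e.functor.map_preimage]
      exact hγ.comp_iso hP (cI X).inv
    · show IsPreStep F (e.functor.map _)
      rw [e.functor.map_preimage]
      exact IsPreStep.comp F (isPreStep_of_isIso F (cI X).hom)
        (IsPreStep.comp F hβ (isPreStep_of_isIso F (cI Y).inv))
    · refine IsPullbackMorphism.of_equivalence e ?_
      rw [e.functor.map_preimage]
      exact IsPullbackMorphism.comp F (isPullbackMorphism_of_isIso F (cI Y).hom) hα
  -- (iv)(a) uniqueness
  · intro A B X Y X' Y' φ γ β α γ' β' α' h1 hγ hβ hα h2 hγ' hβ' hα'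
    obtain ⟨ε, δ, hε, hδ, hαδ⟩ := hF.iv_a_unique (e.functor.map φ) (e.functor.map γ)
      (e.functor.map β) (e.functor.map α) (e.functor.map γ') (e.functor.map β') (e.functor.map α')
      (by rw [← Functor.map_comp, ← Functor.map_comp, h1])
      ((isFrobeniusType_equivalence_iff e hP γ).mp hγ) hβ (hα.map_of_equivalence e)
      (by rw [← Functor.map_comp, ← Functor.map_comp, h2])
      ((isFrobeniusType_equivalence_iff e hP γ').mp hγ') hβ' (hα'.map_of_equivalence e)
    refine ⟨e.functor.preimageIso ε, e.functor.preimageIso δ, ?_, ?_, ?_⟩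
    · apply e.functor.map_injective
      rw [Functor.map_comp, Functor.preimageIso_hom, e.functor.map_preimage]
      exact hε
    · apply e.functor.map_injective
      rw [Functor.map_comp, Functor.map_comp, Functor.preimageIso_hom, Functor.preimageIso_hom,
        e.functor.map_preimage, e.functor.map_preimage]
      exact hδ
    · apply e.functor.map_injective
      rw [Functor.map_comp, Functor.preimageIso_hom, e.functor.map_preimage]
      exact hαδ
  -- (iv)(b)
  · intro A B φ h
    have h' := hF.iv_b (e.functor.map φ) (h.map_of_equivalence e)
    exact ⟨(isLBInvertible_equivalence_iff e hP φ).mpr h'.1, h'.2⟩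
  -- (v)(a)
  · intro A B φ h
    haveI := hF.v_a (e.functor.map φ) h
    exact e.functor.mono_of_mono_map (f := φ) inferInstance
  -- (v)(b) existence
  · intro A B φ h
    obtain ⟨X, β, α, hfac, hβ, hα⟩ := hF.v_b_exists (e.functor.map φ) h
    refine ⟨e.inverse.obj X, e.functor.preimage (β ≫ (cI X).inv), e.functor.preimage ((cI X).hom ≫ α),
      ?_, ?_, ?_⟩
    · apply e.functor.map_injective
      simp only [Functor.map_comp, Functor.map_preimage, Category.assoc, Iso.inv_hom_id_assoc]
      exact hfac
    · refine (isCoAngularPreStep_equivalence_iff e hP _).mpr ?_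
      rw [e.functor.map_preimage]
      exact hβ.comp_iso (cI X).inv
    · refine ⟨?_, ?_⟩
      · show IsIsometry F (e.functor.map _)
        rw [e.functor.map_preimage]
        exact IsIsometry.comp F (isIsometry_of_isIso F hP (cI X).hom) hα.1
      · show IsPreStep F (e.functor.map _)
        rw [e.functor.map_preimage]
        exact IsPreStep.comp F (isPreStep_of_isIso F (cI X).hom) hα.2
  -- (v)(b) uniqueness
  · intro A B X X' φ β α β' α' h1 hβ hα h2 hβ' hα'
    obtain ⟨γ, hγ1, hγ2⟩ := hF.v_b_unique (e.functor.map φ) (e.functor.map β) (e.functor.map α)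
      (e.functor.map β') (e.functor.map α') (by rw [← Functor.map_comp, h1])
      ((isCoAngularPreStep_equivalence_iff e hP β).mp hβ) hα (by rw [← Functor.map_comp, h2])
      ((isCoAngularPreStep_equivalence_iff e hP β').mp hβ') hα'
    refine ⟨e.functor.preimageIso γ, ?_, ?_⟩
    · apply e.functor.map_injective
      rw [Functor.map_comp, Functor.preimageIso_hom, e.functor.map_preimage]
      exact hγ1
    · apply e.functor.map_injective
      rw [Functor.map_comp, Functor.preimageIso_hom, e.functor.map_preimage]
      exact hγ2
  -- (v)(c) existence
  · intro A B φ h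
    obtain ⟨X, β, α, hfac, hβ, hα⟩ := hF.v_c_exists (e.functor.map φ) h
    refine ⟨e.inverse.obj X, e.functor.preimage (β ≫ (cI X).inv), e.functor.preimage ((cI X).hom ≫ α),
      ?_, ?_, ?_⟩
    · apply e.functor.map_injective
      simp only [Functor.map_comp, Functor.map_preimage, Category.assoc, Iso.inv_hom_id_assoc]
      exact hfac
    · refine ⟨?_, ?_⟩
      · show IsIsometry F (e.functor.map _)
        rw [e.functor.map_preimage]
        exact IsIsometry.comp F hβ.1 (isIsometry_of_isIso F hP (cI X).inv)
      · show IsPreStep F (e.functor.map _)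
        rw [e.functor.map_preimage]
        exact IsPreStep.comp F hβ.2 (isPreStep_of_isIso F (cI X).inv)
    · refine (isCoAngularPreStep_equivalence_iff e hP _).mpr ?_
      rw [e.functor.map_preimage]
      exact hα.iso_comp (cI X).hom
  -- (v)(c) uniqueness
  · intro A B X X' φ β α β' α' h1 hβ hα h2 hβ' hα'
    obtain ⟨γ, hγ1, hγ2⟩ := hF.v_c_unique (e.functor.map φ) (e.functor.map β) (e.functor.map α)
      (e.functor.map β') (e.functor.map α') (by rw [← Functor.map_comp, h1]) hβ
      ((isCoAngularPreStep_equivalence_iff e hP α).mp hα) (by rw [← Functor.map_comp, h2]) hβ'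
      ((isCoAngularPreStep_equivalence_iff e hP α').mp hα')
    refine ⟨e.functor.preimageIso γ, ?_, ?_⟩
    · apply e.functor.map_injective
      rw [Functor.map_comp, Functor.preimageIso_hom, e.functor.map_preimage]
      exact hγ1
    · apply e.functor.map_injective
      rw [Functor.map_comp, Functor.preimageIso_hom, e.functor.map_preimage]
      exact hγ2
  -- (vi)
  · intro A B φ ψ hφ hψ hb hm
    obtain ⟨α, hα, hcomp⟩ := hF.vi (e.functor.map φ) (e.functor.map ψ)
      ((isCoAngularPreStep_equivalence_iff e hP φ).mp hφ)
      ((isCoAngularPreStep_equivalence_iff e hP ψ).mp hψ) hb hm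
    obtain ⟨α', hα', hmap⟩ := exists_preimage_mem_unitsSubgroup e α hα
    refine ⟨α', hα', e.functor.map_injective ?_⟩
    have hh : e.functor.map α'.hom = α.hom := by
      rw [← hmap]
      rfl
    rw [Functor.map_comp, hh, hcomp]
  -- (vii)(a)
  · intro A
    obtain ⟨B, φ, hφ⟩ := hF.vii_a (e.functor.obj A)
    refine ⟨e.inverse.obj B, e.functor.preimage (φ ≫ (cI B).inv), IsIsotropicHull.of_equivalence e hP ?_⟩
    rw [e.functor.map_preimage]
    exact IsIsotropicHull.comp_iso hP hφ (cI B).symm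
  -- (vii)(b)
  · intro A B φ hA
    exact IsIsotropic.of_equivalence e (hF.vii_b (e.functor.map φ) (hA.map_of_equivalence e hP))

/-- `Functor.IsEquivalence` form: precomposing a Frobenioid structure with an equivalence of
categories gives a Frobenioid. [cite: MochizukiFrdI2008, Def. 1.3 p.24] -/
theorem IsFrobenioid.comp_of_isEquivalence (G : C' ⥤ C) [G.IsEquivalence] (hF : IsFrobenioid F) :
    IsFrobenioid (G ⋙ F) :=
  IsFrobenioid.comp_equivalence G.asEquivalence hF

/-- `Functor.IsEquivalence` form for pre-Frobenioids. [cite: MochizukiFrdI2008, Def. 1.1(iv) p.19] -/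
theorem _root_.Literature.AlgebraicGeometry.Frobenioids.IsPreFrobenioid.comp_of_isEquivalence
    (G : C' ⥤ C) [G.IsEquivalence] (hP : IsPreFrobenioid Φ F) : IsPreFrobenioid Φ (G ⋙ F) :=
  IsPreFrobenioid.comp_equivalence G.asEquivalence hP

/-- Of isotropic type along an equivalence of a pre-Frobenioid. [cite: MochizukiFrdI2008, Def. 1.2(v) p.23] -/
theorem isOfIsotropicType_comp_equivalence (h : IsOfIsotropicType F) :
    IsOfIsotropicType (e.functor ⋙ F) :=
  fun A => IsIsotropic.of_equivalence e (h (e.functor.obj A))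

/-- Of Frobenius-trivial type along an equivalence. [cite: MochizukiFrdI2008, Def. 1.2(v) p.23] -/
theorem isOfFrobeniusTrivialType_comp_equivalence (h : IsOfFrobeniusTrivialType F) :
    IsOfFrobeniusTrivialType (e.functor ⋙ F) :=
  fun A => IsFrobeniusTrivial.of_equivalence e (h (e.functor.obj A))

end PreFrobenioid

end Literature.AlgebraicGeometry.Frobenioids
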